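import Summits.QuantumFields.YangMills.Theorems.BalabanUVNodesN18CorrLipschitz

/-!
# BalabanUVNodes ∕ node N18 = NE5 — closure-ledger item (iii), (β2) fourth brick (ASSEMBLY): THE SECOND-ORDER REMAINDER OF THE (0.4) AVERAGE OF RECORD IS
# LIPSCHITZ IN THE CONFIGURATION — `R_c(U) = Ū(c) − 1 − (Q₁Y)(c)` (bounded by `81(ℓδ)²` in `BlockAveragingEMLLinearised.norm_avgFun_sub_one_sub_linAvg_le`) satisfies
# `‖R_c(U) − R_c(U′)‖ ≤ 181·ℓ²·δ·sup_b‖U_b − U′_b‖` for configurations within `δ` of `1`, `24ℓδ ≤ 1`, `ℓδ < δ_N` (Track A, DAG node N18 = `T4OutputRate.NE5` :211;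
# cluster K4 «SpineRates», item K3⁷ `SpineGivenEndpointR13SepCoPH`; module 25 of seat pub-ymgap-dag-n18-d, strategy s2)

HONEST FRAMING.  Count-neutral kernel bookkeeping (`--supports stmt-QuantumFields-20544 --as helper`); elementary, PROVED by assembling modules 22–24 along the C⁰
proof's decomposition `Ū(c) − 1 − Q₁Y = (κ−1)(S−1) + (κ − 1 − M) + |I|⁻¹Σᵢ Eᵢ`.  This is print's «`C(V₀, A)` is an analytic function of `A` whose Taylor expansion begins
with a second-order polynomial» ([Balaban1985Averaging] Prop 3 p.36) in the C¹ form the (1.12) half of N18's transport clause needs (the seat's `N18-BETA-SPEC.md`, (β2)).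
NE5 is NOT PRINTED and NOT proved; N18 is NOT discharged; the C¹ statement's USE (coarse differences of the averaged field through `BlockAveraging.avgFun_translate`,
then the letters of (1.12)) is the next step, not here.

WHAT.  `norm_mean_le'`, `mean_const'` (private arithmetic of means), `dist1_loopHol_le_local` (every loop variable within `ℓδ` of `1`, walk-local zeroth order, no
smallness), ★ `norm_avgRem_sub_avgRem_le` (the statement in the title).

WHAT THIS IS NOT.  Not the (1.12) letters of a transported field; not (β); finite tori — not continuum ∕ OS ∕ mass gap ∕ Clay.  0 `def`, 0 `sorry`, standard axioms.
-/

open scoped BigOperators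

namespace YMDAG.N18.HolonomyLipschitz

open Literature.MathematicalPhysics.QuantumFieldTheory.Balaban1983to89
open Literature.MathematicalPhysics.QuantumFieldTheory.Balaban1983to89.T4Continuum
open Literature.MathematicalPhysics.QuantumFieldTheory.Balaban1983to89.BlockAveraging
open Literature.MathematicalPhysics.QuantumFieldTheory.Balaban1983to89.AveragingRT (axialAvg)
open Literature.MathematicalPhysics.QuantumFieldTheory.Balaban1983to89.ExpMeanLog (deltaSU expMeanLogSU)
open Literature.MathematicalPhysics.QuantumFieldTheory.Balaban1983to89.LatticeWordStokes (length_loopWord_le)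
open Literature.MathematicalPhysics.QuantumFieldTheory.Balaban1983to89.BlockAveragingEMLLinearised (walkSum linAvg linAvg_def length_walk
  length_walk_replicate_le)

section Assembly

open scoped Matrix.Norms.L2Operator

variable {n : Type*} [Fintype n] [DecidableEq n] [Nonempty n] {P : Params} {j : ℕ}

omit [Nonempty n] in
/-- The mean of a family bounded by `B` in norm has norm `≤ B`. [folklore] -/
private theorem norm_mean_le' {ι : Type*} [Fintype ι] [Nonempty ι] {m : ι → Matrix n n ℂ} {B : ℝ} (h : ∀ i, ‖m i‖ ≤ B) :
    ‖((Fintype.card ι : ℂ))⁻¹ • ∑ i, m i‖ ≤ B := by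
  have hc : (0 : ℝ) < Fintype.card ι := Nat.cast_pos.mpr Fintype.card_pos
  have hsum : ∑ i, ‖m i‖ ≤ ∑ _i : ι, B := Finset.sum_le_sum fun i _ => h i
  rw [Finset.sum_const, Finset.card_univ, nsmul_eq_mul] at hsum
  rw [norm_smul, norm_inv, Complex.norm_natCast, inv_mul_le_iff₀ hc]
  exact (norm_sum_le _ _).trans hsum

omit [Fintype n] [DecidableEq n] [Nonempty n] in
/-- The mean of a constant family is the constant. [folklore] -/
private theorem mean_const' {ι : Type*} [Fintype ι] [Nonempty ι] (X : Matrix n n ℂ) : ((Fintype.card ι : ℂ))⁻¹ • ∑ _i : ι, X = X := by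
  have hc : (Fintype.card ι : ℂ) ≠ 0 := Nat.cast_ne_zero.mpr Fintype.card_pos.ne'
  rw [Finset.sum_const, Finset.card_univ, ← Nat.cast_smul_eq_nsmul ℂ, smul_smul, inv_mul_cancel₀ hc, one_smul]

/-- **Every (0.4) loop variable is within `ℓδ` of `1`** when the bond variables are within `δ` of `1` (loop words have `≤ ℓ = (d+2)L` steps; walk-local zeroth order of
module 23, NO smallness — the C⁰ file's `2ℓδ` under `2ℓδ ≤ 1` improved). [cite: Balaban1987RG1, (0.3)-(0.4) pp.252-253] -/
theorem dist1_loopHol_le_local (U : GaugeField P j (Matrix.specialUnitaryGroup n ℂ)) {δ : ℝ} (hδ : 0 ≤ δ)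
    (hU : ∀ b, ‖((U b : Matrix.specialUnitaryGroup n ℂ) : Matrix n n ℂ) - 1‖ ≤ δ) (c : PBond P (j + 1)) (i : Idx P) :
    dist1 (loopHol U c i) ≤ ((((P.d + 2) * P.L : ℕ) : ℝ)) * δ := by
  rw [FederbushMean.dist1_SU_eq]
  unfold loopHol
  have hlen : ((walk (emb c.src) (loopWord P.L c.dir (off i.1) i.2.1 i.2.2)).length : ℝ) ≤ (((P.d + 2) * P.L : ℕ) : ℝ) := by
    exact_mod_cast (length_walk _ _).le.trans (length_loopWord_le c i)
  exact (norm_holAt_sub_one_le_local U _ fun s _ => hU s.bond).trans (mul_le_mul_of_nonneg_right hlen hδ)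

/-- ★ **THE SECOND-ORDER REMAINDER OF THE (0.4) AVERAGE OF RECORD IS LIPSCHITZ IN THE CONFIGURATION** ([Balaban1985Averaging] Prop 3's «analytic function of `A`
whose Taylor expansion begins with a second-order polynomial», C¹ form, flat background, `exp[mean log]` on `SU(N)`).  If every bond variable of `U` and of `U′`
is within `δ` of `1`, the two are within `ε` bondwise, `24ℓδ ≤ 1` and `ℓδ < δ_N` (`ℓ = (d+2)L`), then for every coarse bond `c`
`‖(Ū(c) − 1 − (Q₁Y)(c)) − (Ū′(c) − 1 − (Q₁Y′)(c))‖ ≤ 181·ℓ²·δ·ε` (`Ū = avgFun expMeanLogSU U`, `Y = U − 1`, `Q₁ = linAvg`).  Assembly of modules 22–24 along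
`Ū(c) − 1 − Q₁Y = (κ−1)(S−1) + (κ−1−M) + |I|⁻¹Σᵢ Eᵢ` (the C⁰ companion `norm_avgFun_sub_one_sub_linAvg_le` gives `81(ℓδ)²`).
[cite: Balaban1985Averaging, Prop. 3 (122)-(125) p.36; Balaban1987RG1, (0.4) and (0.8) p.253] -/
theorem norm_avgRem_sub_avgRem_le (U U' : GaugeField P j (Matrix.specialUnitaryGroup n ℂ)) {δ ε : ℝ} (hδ : 0 ≤ δ) (hε : 0 ≤ ε)
    (hU : ∀ b, ‖((U b : Matrix.specialUnitaryGroup n ℂ) : Matrix n n ℂ) - 1‖ ≤ δ)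
    (hU' : ∀ b, ‖((U' b : Matrix.specialUnitaryGroup n ℂ) : Matrix n n ℂ) - 1‖ ≤ δ)
    (hUU' : ∀ b, ‖((U b : Matrix.specialUnitaryGroup n ℂ) : Matrix n n ℂ) - ((U' b : Matrix.specialUnitaryGroup n ℂ) : Matrix n n ℂ)‖ ≤ ε)
    (h24 : 24 * ((((P.d + 2) * P.L : ℕ) : ℝ) * δ) ≤ 1) (hN : (((P.d + 2) * P.L : ℕ) : ℝ) * δ < deltaSU n) (c : PBond P (j + 1)) :
    ‖(((avgFun (expMeanLogSU (n := n)) U c : Matrix.specialUnitaryGroup n ℂ) : Matrix n n ℂ) - 1 -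
          linAvg (fun b => ((U b : Matrix.specialUnitaryGroup n ℂ) : Matrix n n ℂ) - 1) c) -
        (((avgFun (expMeanLogSU (n := n)) U' c : Matrix.specialUnitaryGroup n ℂ) : Matrix n n ℂ) - 1 -
          linAvg (fun b => ((U' b : Matrix.specialUnitaryGroup n ℂ) : Matrix n n ℂ) - 1) c)‖ ≤
      181 * ((((P.d + 2) * P.L : ℕ) : ℝ)) ^ 2 * δ * ε := by
  -- letters
  set ℓ : ℝ := (((P.d + 2) * P.L : ℕ) : ℝ) with hℓ
  set θ : ℝ := ℓ * δ with hθ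
  have hℓ0 : 0 ≤ ℓ := Nat.cast_nonneg _
  have hθ0 : 0 ≤ θ := mul_nonneg hℓ0 hδ
  have hθ24 : θ ≤ 1 / 24 := by rw [hθ]; linarith
  have hθ1 : θ ≤ 1 := hθ24.trans (by norm_num)
  have hℓδ1 : ℓ * δ ≤ 1 := hθ1
  set Y : PBond P j → Matrix n n ℂ := fun b => ((U b : Matrix.specialUnitaryGroup n ℂ) : Matrix n n ℂ) - 1 with hY
  set Y' : PBond P j → Matrix n n ℂ := fun b => ((U' b : Matrix.specialUnitaryGroup n ℂ) : Matrix n n ℂ) - 1 with hY'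
  -- loop variables within `θ` of `1`
  have hloop : ∀ i, dist1 (loopHol U c i) ≤ θ := fun i => dist1_loopHol_le_local U hδ hU c i
  have hloop' : ∀ i, dist1 (loopHol U' c i) ≤ θ := fun i => dist1_loopHol_le_local U' hδ hU' c i
  -- the correction factors
  set κ : Matrix n n ℂ := ((corr (expMeanLogSU (n := n)) U c : Matrix.specialUnitaryGroup n ℂ) : Matrix n n ℂ) with hκdef
  set κ' : Matrix n n ℂ := ((corr (expMeanLogSU (n := n)) U' c : Matrix.specialUnitaryGroup n ℂ) : Matrix n n ℂ) with hκ'def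
  set M : Matrix n n ℂ := ((Fintype.card (Idx P) : ℂ))⁻¹ •
    ∑ i, (((loopHol U c i : Matrix.specialUnitaryGroup n ℂ) : Matrix n n ℂ) - 1) with hM
  set M' : Matrix n n ℂ := ((Fintype.card (Idx P) : ℂ))⁻¹ •
    ∑ i, (((loopHol U' c i : Matrix.specialUnitaryGroup n ℂ) : Matrix n n ℂ) - 1) with hM'
  have hκrem : ‖(κ - 1 - M) - (κ' - 1 - M')‖ ≤ 144 * θ * (ℓ * ε) := norm_corrRem_sub_corrRem_le U U' c hloop hloop' hN hθ24 hε hUU'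
  have hκ'1 : ‖κ' - 1‖ ≤ 2 * θ := by
    rw [hκ'def, ← FederbushMean.dist1_SU_eq]
    exact BlockAveragingEMLProp2.dist1_corr_le_two_mul U' c hloop' hN (hθ24.trans (by norm_num))
  have hMM' : ‖M - M'‖ ≤ ℓ * ε := by
    rw [hM, hM', ← smul_sub, ← Finset.sum_sub_distrib]
    refine norm_mean_le' fun i => ?_
    rw [sub_sub_sub_cancel_right]
    exact norm_loopHol_sub_loopHol_le U U' hε hUU' c i
  have hκκ' : ‖κ - κ'‖ ≤ 144 * θ * (ℓ * ε) + ℓ * ε := by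
    have e : κ - κ' = ((κ - 1 - M) - (κ' - 1 - M')) + (M - M') := by abel
    rw [e]; exact (norm_add_le _ _).trans (add_le_add hκrem hMM')
  -- the straight factors
  set S : Matrix n n ℂ := ((axialAvg U c : Matrix.specialUnitaryGroup n ℂ) : Matrix n n ℂ) with hSdef
  set S' : Matrix n n ℂ := ((axialAvg U' c : Matrix.specialUnitaryGroup n ℂ) : Matrix n n ℂ) with hS'def
  have hγS_len : ((walk (emb c.src) (List.replicate P.L (c.dir, true))).length : ℝ) ≤ ℓ := by
    rw [hℓ]; exact_mod_cast length_walk_replicate_le (P := P) (j := j) _ _ _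
  have hS1 : ‖S - 1‖ ≤ θ := by
    rw [hSdef, axialAvg_eq_holAt_walk U c]
    exact (norm_holAt_sub_one_le_local U _ fun s _ => hU s.bond).trans (mul_le_mul_of_nonneg_right hγS_len hδ)
  have hSS' : ‖S - S'‖ ≤ ℓ * ε := by
    rw [hSdef, hS'def, axialAvg_eq_holAt_walk U c, axialAvg_eq_holAt_walk U' c]
    exact (norm_holAt_sub_holAt_le_of_forall U U' _ fun s _ => hUU' s.bond).trans (mul_le_mul_of_nonneg_right hγS_len hε)
  -- per-index first-order errors and their Lipschitz bound (module 23)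
  set E : Idx P → Matrix n n ℂ := fun i =>
    (((loopHol U c i : Matrix.specialUnitaryGroup n ℂ) : Matrix n n ℂ) - 1) -
      (walkSum Y (walk (emb c.src) (stairWord i.2.1 (off i.1))) +
        walkSum Y (walk (walkEnd (emb c.src) (stairWord i.2.1 (off i.1))) (List.replicate P.L (c.dir, true))) -
        walkSum Y (walk (emb c.tgt) (stairWord i.2.2 (off i.1))) - (S - 1)) with hE
  set E' : Idx P → Matrix n n ℂ := fun i =>
    (((loopHol U' c i : Matrix.specialUnitaryGroup n ℂ) : Matrix n n ℂ) - 1) -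
      (walkSum Y' (walk (emb c.src) (stairWord i.2.1 (off i.1))) +
        walkSum Y' (walk (walkEnd (emb c.src) (stairWord i.2.1 (off i.1))) (List.replicate P.L (c.dir, true))) -
        walkSum Y' (walk (emb c.tgt) (stairWord i.2.2 (off i.1))) - (S' - 1)) with hE'
  have hEE' : ∀ i, ‖E i - E' i‖ ≤ 28 * ℓ ^ 2 * δ * ε := fun i => norm_loopRem_sub_loopRem_le U U' hδ hε hU hU' hUU' hℓδ1 c i
  -- the means of the loop variables, reorganised
  have hmean : ∀ (V : GaugeField P j (Matrix.specialUnitaryGroup n ℂ)) (T : Matrix n n ℂ) (F : Idx P → Matrix n n ℂ),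
      (∀ i, F i = (((loopHol V c i : Matrix.specialUnitaryGroup n ℂ) : Matrix n n ℂ) - 1) -
        (walkSum (fun b => ((V b : Matrix.specialUnitaryGroup n ℂ) : Matrix n n ℂ) - 1) (walk (emb c.src) (stairWord i.2.1 (off i.1))) +
          walkSum (fun b => ((V b : Matrix.specialUnitaryGroup n ℂ) : Matrix n n ℂ) - 1)
            (walk (walkEnd (emb c.src) (stairWord i.2.1 (off i.1))) (List.replicate P.L (c.dir, true))) -
          walkSum (fun b => ((V b : Matrix.specialUnitaryGroup n ℂ) : Matrix n n ℂ) - 1) (walk (emb c.tgt) (stairWord i.2.2 (off i.1))) - (T - 1))) →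
      ((Fintype.card (Idx P) : ℂ))⁻¹ • ∑ i, (((loopHol V c i : Matrix.specialUnitaryGroup n ℂ) : Matrix n n ℂ) - 1) =
        linAvg (fun b => ((V b : Matrix.specialUnitaryGroup n ℂ) : Matrix n n ℂ) - 1) c - (T - 1) + ((Fintype.card (Idx P) : ℂ))⁻¹ • ∑ i, F i := by
    intro V T F hF
    have hsum : ∑ i, (((loopHol V c i : Matrix.specialUnitaryGroup n ℂ) : Matrix n n ℂ) - 1) =
        ∑ i : Idx P, (walkSum (fun b => ((V b : Matrix.specialUnitaryGroup n ℂ) : Matrix n n ℂ) - 1) (walk (emb c.src) (stairWord i.2.1 (off i.1))) +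
          walkSum (fun b => ((V b : Matrix.specialUnitaryGroup n ℂ) : Matrix n n ℂ) - 1)
            (walk (walkEnd (emb c.src) (stairWord i.2.1 (off i.1))) (List.replicate P.L (c.dir, true))) -
          walkSum (fun b => ((V b : Matrix.specialUnitaryGroup n ℂ) : Matrix n n ℂ) - 1) (walk (emb c.tgt) (stairWord i.2.2 (off i.1)))) -
          ∑ _i : Idx P, (T - 1) + ∑ i, F i := by
      rw [← Finset.sum_sub_distrib, ← Finset.sum_add_distrib]
      refine Finset.sum_congr rfl fun i _ => ?_
      rw [hF i]; abel
    rw [hsum, smul_add, smul_sub, mean_const', linAvg_def]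
  have hMeq : M = linAvg Y c - (S - 1) + ((Fintype.card (Idx P) : ℂ))⁻¹ • ∑ i, E i := hmean U S E fun i => by simp only [hE, hY]
  have hM'eq : M' = linAvg Y' c - (S' - 1) + ((Fintype.card (Idx P) : ℂ))⁻¹ • ∑ i, E' i := hmean U' S' E' fun i => by simp only [hE', hY']
  -- `Ū(c) = κ_c · S`
  have hUavg : ((avgFun (expMeanLogSU (n := n)) U c : Matrix.specialUnitaryGroup n ℂ) : Matrix n n ℂ) = κ * S := by
    rw [hκdef, hSdef, ← Submonoid.coe_mul]; rfl
  have hU'avg : ((avgFun (expMeanLogSU (n := n)) U' c : Matrix.specialUnitaryGroup n ℂ) : Matrix n n ℂ) = κ' * S' := by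
    rw [hκ'def, hS'def, ← Submonoid.coe_mul]; rfl
  -- the remainders decomposed
  have hR : κ * S - 1 - linAvg Y c = (κ - 1) * (S - 1) + (κ - 1 - M) + ((Fintype.card (Idx P) : ℂ))⁻¹ • ∑ i, E i := by
    have e : κ * S - 1 - linAvg Y c = (κ - 1) * (S - 1) + (κ - 1 - M) + (M - linAvg Y c + (S - 1)) := by noncomm_ring
    rw [e, hMeq]; abel
  have hR' : κ' * S' - 1 - linAvg Y' c = (κ' - 1) * (S' - 1) + (κ' - 1 - M') + ((Fintype.card (Idx P) : ℂ))⁻¹ • ∑ i, E' i := by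
    have e : κ' * S' - 1 - linAvg Y' c = (κ' - 1) * (S' - 1) + (κ' - 1 - M') + (M' - linAvg Y' c + (S' - 1)) := by noncomm_ring
    rw [e, hM'eq]; abel
  have hmeanE : ((Fintype.card (Idx P) : ℂ))⁻¹ • ∑ i, E i - ((Fintype.card (Idx P) : ℂ))⁻¹ • ∑ i, E' i =
      ((Fintype.card (Idx P) : ℂ))⁻¹ • ∑ i, (E i - E' i) := by rw [← smul_sub, ← Finset.sum_sub_distrib]
  have e : (κ * S - 1 - linAvg Y c) - (κ' * S' - 1 - linAvg Y' c) =
      ((κ - κ') * (S - 1) + (κ' - 1) * (S - S')) + ((κ - 1 - M) - (κ' - 1 - M')) + ((Fintype.card (Idx P) : ℂ))⁻¹ • ∑ i, (E i - E' i) := by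
    rw [hR, hR', ← hmeanE]; noncomm_ring
  rw [hUavg, hU'avg, e]
  have hbil : ‖(κ - κ') * (S - 1) + (κ' - 1) * (S - S')‖ ≤ (144 * θ * (ℓ * ε) + ℓ * ε) * θ + 2 * θ * (ℓ * ε) :=
    (norm_add_le _ _).trans (add_le_add ((norm_mul_le _ _).trans (mul_le_mul hκκ' hS1 (norm_nonneg _) (by positivity)))
      ((norm_mul_le _ _).trans (mul_le_mul hκ'1 hSS' (norm_nonneg _) (by positivity))))
  have hmeanEE : ‖((Fintype.card (Idx P) : ℂ))⁻¹ • ∑ i, (E i - E' i)‖ ≤ 28 * ℓ ^ 2 * δ * ε := norm_mean_le' hEE'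
  calc ‖((κ - κ') * (S - 1) + (κ' - 1) * (S - S')) + ((κ - 1 - M) - (κ' - 1 - M')) + ((Fintype.card (Idx P) : ℂ))⁻¹ • ∑ i, (E i - E' i)‖
      ≤ ‖(κ - κ') * (S - 1) + (κ' - 1) * (S - S')‖ + ‖(κ - 1 - M) - (κ' - 1 - M')‖ + ‖((Fintype.card (Idx P) : ℂ))⁻¹ • ∑ i, (E i - E' i)‖ :=
        (norm_add_le _ _).trans (add_le_add ((norm_add_le _ _).trans le_rfl) le_rfl)
    _ ≤ ((144 * θ * (ℓ * ε) + ℓ * ε) * θ + 2 * θ * (ℓ * ε)) + 144 * θ * (ℓ * ε) + 28 * ℓ ^ 2 * δ * ε := add_le_add (add_le_add hbil hκrem) hmeanEE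
    _ = (175 + 144 * θ) * ℓ ^ 2 * δ * ε := by rw [hθ]; ring
    _ ≤ 181 * ℓ ^ 2 * δ * ε := by
        have h6 : 144 * θ ≤ 6 := by linarith
        have hpos : 0 ≤ ℓ ^ 2 * δ * ε := by positivity
        nlinarith

end Assembly

end YMDAG.N18.HolonomyLipschitz
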